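import Summits.ValiantsHypothesis.ValiantsHypothesis.Theses.DefinabilityGap
import Summits.ValiantsHypothesis.ValiantsHypothesis.Theorems.DefinabilityGapVQPwsRung
import HarnessLib

/-!
# DefinabilityGap — the aside `CollapseToVQPws` HOLDS (item `stmt-ValiantsHypothesis-23705`)

decomp-valiant lens 5, gen 2. The route's aside `CollapseToVQPws` (the quasi-polynomial rung one notch below the split child
`CollapseToVPws`: `VP = VNP ⟹` every `VNP` family has quasi-polynomially bounded weakly-skew complexity) is a THEOREM:
`Theorems/DefinabilityGapVQPwsRung.isQPBounded_wsComplexity_of_isVNPFamily_of_collapse` (VP ⊆ VQP_ws via formulas of size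
`n^{O(log n)}`, BLMW 2011 §6, composed with the collapse). This file closes the item.
-/

noncomputable section

namespace Summit.ValiantsHypothesis.ValiantsHypothesis.Theorems.DefinabilityGapVQPwsAside

/-- **`CollapseToVQPws` holds**: under `VP = VNP`, `VNP ⊆ VQP_ws`. [cite: BurgisserEtAl2011, §6 (formulas of size
`n^{O(log n)}` for VP); Burgisser2000, Def. 2.4, Def. 2.8] -/
theorem collapseToVQPws_holds : Summit.ValiantsHypothesis.ValiantsHypothesis.Theses.DefinabilityGap.CollapseToVQPws :=
  fun hEq _ _ hf =>
    Summit.ValiantsHypothesis.ValiantsHypothesis.Theorems.DefinabilityGapVQPwsRung.isQPBounded_wsComplexity_of_isVNPFamily_of_collapse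
      hEq hf

end Summit.ValiantsHypothesis.ValiantsHypothesis.Theorems.DefinabilityGapVQPwsAside

end
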